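import Summits.Parity.BatemanHorn.Theorems.SelbergDelangeRigidityLSDRealSegmentTailsTwoSmooth
import Summits.Parity.BatemanHorn.Theorems.SelbergDelangeRigidityLSDRealSegmentTailsPeeled
import Summits.Parity.BatemanHorn.Theorems.SelbergDelangeRigidityLSDRealSegmentEulerFactorAux
import Mathlib.NumberTheory.Primorial
import HarnessLib

/-!
# Route `SelbergDelangeRigidity`, crux `LSDRealSegment` (stmt-Parity-9770), line
# `product-anatomy-subcritical`: slicing by exact smooth parts (small-prime restoration of `stub_tailsTwo`)

For a tuple `s = (sᵢ)` of `P`-smooth numbers put `L = lcm(s)` and `M = L · P#` (`P#` the primorial).  The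
SLICE of `s` is the set of `n` with `smoothPart P (fᵢ(n)) = sᵢ` for every `i`; by `smoothPart_eq_iff` it is cut
out by the divisibility conditions `sᵢ ∣ fᵢ(n)`, `p^{v_p(sᵢ)+1} ∤ fᵢ(n)` (`p ≤ P`), all to moduli dividing `M`,
hence it is `M`-PERIODIC: a union of residue classes `r mod M`.  This file proves the periodicity, the
identification with the exact smooth parts, the decomposition of a block sum over a slice into its classes and the
re-indexing `n = r + M t` of one class as an interval in `t`, and the class count
`#{r mod M in the slice} ≤ P# · ρ_F(L)` with `ρ_F(L) ≤ C^{π(P)}` (`tailsTwo_slice_card`, registered helper;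
`ρ_F(p^a) ≤ C` uniformly is `exists_polyRootCountMod_prime_pow_le_of_system`).
-/

open Filter Finset Polynomial
open scoped BigOperators Topology Classical

namespace Summit.Parity.BatemanHorn.Cruxes.LSDRealSegment.ProductAnatomySubcritical

open Literature.NumberTheory.Sieve
open ArithmeticFunction (cardFactors)
noncomputable section

variable {k : ℕ}

/-! ### The modulus `M = lcm(s) · P#` -/

/-- `sᵢ ∣ lcm(s)`. [folklore] -/
theorem dvd_univ_lcm (s : Fin k → ℕ) (i : Fin k) : s i ∣ Finset.univ.lcm s :=
  Finset.dvd_lcm (Finset.mem_univ i)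

/-- `lcm(s) ≠ 0` when all `sᵢ ≠ 0`. [folklore] -/
theorem univ_lcm_ne_zero {s : Fin k → ℕ} (hs : ∀ i, s i ≠ 0) : Finset.univ.lcm s ≠ 0 := by
  rw [Ne, Finset.lcm_eq_zero_iff]
  push Not
  exact fun i _ => hs i

/-- The prime factors of `lcm(s)` are prime factors of some `sᵢ`; so `lcm(s)` is `P`-smooth if all `sᵢ` are. [folklore] -/
theorem primeFactors_univ_lcm_le {s : Fin k → ℕ} {P : ℕ} (hs : ∀ i, s i ≠ 0)
    (hsP : ∀ i, ∀ p ∈ (s i).primeFactors, p ≤ P) : ∀ p ∈ (Finset.univ.lcm s).primeFactors, p ≤ P := by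
  intro p hp
  have hp' := Nat.prime_of_mem_primeFactors hp
  have hdvd := Nat.dvd_of_mem_primeFactors hp
  -- a prime dividing an lcm divides a member
  have key : ∀ S : Finset (Fin k), p ∣ S.lcm s → ∃ i ∈ S, p ∣ s i := by
    intro S
    induction S using Finset.induction_on with
    | empty =>
      intro h
      rw [Finset.lcm_empty] at h
      exact absurd (Nat.le_of_dvd one_pos h) (by have := hp'.one_lt; omega)
    | insert a S ha ih =>
      intro h
      rw [Finset.lcm_insert] at h
      have hmul : lcm (s a) (S.lcm s) ∣ s a * S.lcm s := Dvd.intro_left _ (Nat.gcd_mul_lcm (s a) (S.lcm s))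
      rcases (Nat.Prime.dvd_mul hp').mp (h.trans hmul) with h1 | h1
      · exact ⟨a, Finset.mem_insert_self a S, h1⟩
      · obtain ⟨i, hi, h2⟩ := ih h1
        exact ⟨i, Finset.mem_insert_of_mem hi, h2⟩
  obtain ⟨i, -, hi⟩ := key Finset.univ hdvd
  exact hsP i p (Nat.mem_primeFactors.mpr ⟨hp', hi, hs i⟩)

/-- A prime `p ≤ P` to the power `v_p(sᵢ)+1` divides `M = lcm(s) · P#`. [folklore] -/
theorem pow_factorization_succ_dvd (s : Fin k → ℕ) (i : Fin k) {P p : ℕ} (hp : p.Prime) (hpP : p ≤ P) :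
    p ^ ((s i).factorization p + 1) ∣ Finset.univ.lcm s * primorial P := by
  rw [pow_succ]
  refine mul_dvd_mul ((Nat.ordProj_dvd (s i) p).trans (dvd_univ_lcm s i)) ?_
  rw [primorial_eq_prod_primesLE]
  exact Finset.dvd_prod_of_mem _ (Nat.mem_primesLE.mpr ⟨hpP, hp⟩)

/-- A prime `p > P` is coprime to `M = lcm(s) · P#` when the `sᵢ` are `P`-smooth. [folklore] -/
theorem coprime_lcm_mul_primorial {s : Fin k → ℕ} {P p : ℕ} (hs : ∀ i, s i ≠ 0)
    (hsP : ∀ i, ∀ q ∈ (s i).primeFactors, q ≤ P) (hp : p.Prime) (hPp : P < p) :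
    p.Coprime (Finset.univ.lcm s * primorial P) := by
  rw [hp.coprime_iff_not_dvd]
  intro h
  rcases hp.dvd_mul.mp h with h1 | h1
  · have := primeFactors_univ_lcm_le hs hsP p (Nat.mem_primeFactors.mpr ⟨hp, h1, univ_lcm_ne_zero hs⟩)
    omega
  · have : p ∈ (primorial P).primeFactors := Nat.mem_primeFactors.mpr ⟨hp, h1, primorial_ne_zero P⟩
    rw [primeFactors_primorial, Nat.mem_primesLE] at this
    omega

/-! ### The slice predicate: periodicity and the exact smooth parts -/

/-- Divisibility of `g(n)` by a fixed `d` is `(c d)`-periodic in `n`. [folklore] -/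
theorem periodic_dvd_eval_mul (g : ℤ[X]) (d c : ℕ) :
    Function.Periodic (fun n : ℕ => (d : ℤ) ∣ g.eval (n : ℤ)) (c * d) := by
  have h : Function.Periodic (fun n : ℕ => (d : ℤ) ∣ g.eval (n : ℤ)) d := by
    intro n
    simp only [eq_iff_iff]
    have hsub : ((n + d : ℕ) : ℤ) - (n : ℤ) ∣ g.eval ((n + d : ℕ) : ℤ) - g.eval (n : ℤ) :=
      Polynomial.sub_dvd_eval_sub _ _ _
    rw [show ((n + d : ℕ) : ℤ) - (n : ℤ) = d by push_cast; ring] at hsub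
    exact dvd_iff_dvd_of_dvd_sub hsub
  exact h.nat_mul c

/-- **The slice predicate is `M`-periodic** (`M = lcm(s) · P#`): every condition is a divisibility of some `fᵢ(n)`
by a divisor of `M`. [folklore] -/
theorem periodic_slice (f : Fin k → ℤ[X]) (s : Fin k → ℕ) (P : ℕ) :
    Function.Periodic (fun n : ℕ => ∀ i, ((s i : ℕ) : ℤ) ∣ (f i).eval (n : ℤ) ∧
      ∀ p ∈ Nat.primesLE P, ¬ ((p ^ ((s i).factorization p + 1) : ℕ) : ℤ) ∣ (f i).eval (n : ℤ))
      (Finset.univ.lcm s * primorial P) := by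
  set M := Finset.univ.lcm s * primorial P with hM
  intro n
  simp only [eq_iff_iff]
  refine forall_congr' fun i => and_congr ?_ (forall_congr' fun p => forall_congr' fun hp => not_congr ?_)
  · obtain ⟨c, hc⟩ : s i ∣ M := (dvd_univ_lcm s i).trans (Dvd.intro _ rfl)
    have := periodic_dvd_eval_mul (f i) (s i) c n
    rw [mul_comm, ← hc] at this
    exact iff_of_eq this
  · rw [Nat.mem_primesLE] at hp
    obtain ⟨c, hc⟩ : p ^ ((s i).factorization p + 1) ∣ M := pow_factorization_succ_dvd s i hp.2 hp.1
    have := periodic_dvd_eval_mul (f i) (p ^ ((s i).factorization p + 1)) c n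
    rw [mul_comm, ← hc] at this
    exact iff_of_eq this

/-- **The slice is the set of exact smooth parts**: for `n` with all `fᵢ(n) ≥ 1` and `P`-smooth `sᵢ ≥ 1`,
the slice predicate holds at `n` iff `smoothPart P (fᵢ(n)) = sᵢ` for every `i`. [folklore] -/
theorem slice_iff_smoothPart_eq {f : Fin k → ℤ[X]} {s : Fin k → ℕ} {P : ℕ} (hs : ∀ i, s i ≠ 0)
    (hsP : ∀ i, ∀ p ∈ (s i).primeFactors, p ≤ P) {n : ℕ} (hn : ∀ i, (1 : ℤ) ≤ (f i).eval (n : ℤ)) :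
    (∀ i, ((s i : ℕ) : ℤ) ∣ (f i).eval (n : ℤ) ∧
      ∀ p ∈ Nat.primesLE P, ¬ ((p ^ ((s i).factorization p + 1) : ℕ) : ℤ) ∣ (f i).eval (n : ℤ)) ↔
    ∀ i, smoothPart (P : ℝ) (val f i n) = s i := by
  refine forall_congr' fun i => ?_
  have hv : val f i n = ((f i).eval (n : ℤ)).natAbs := val_eq_natAbs hn i
  have hv0 : val f i n ≠ 0 := by rw [hv]; have := hn i; omega
  rw [smoothPart_eq_iff hv0 (hs i) (fun p hp => by exact_mod_cast hsP i p hp), hv, ← Int.natCast_dvd]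
  refine and_congr Iff.rfl ⟨fun h p hp hpP => ?_, fun h p hp => ?_⟩
  · have hpP' : p ≤ P := by exact_mod_cast hpP
    have := h p (Nat.mem_primesLE.mpr ⟨hpP', hp⟩)
    rwa [Int.natCast_dvd] at this
  · rw [Nat.mem_primesLE] at hp
    rw [Int.natCast_dvd]
    exact h p hp.2 (by exact_mod_cast hp.1)

/-! ### Decomposition of a block sum over a slice into residue classes -/

/-- A sum over the members of a periodic set in a block splits over the residue classes of the period that lie in
the set. [folklore] -/
theorem sum_filter_periodic_eq_sum_classes {E : ℕ → Prop} {M : ℕ} (hM : 0 < M) (hE : Function.Periodic E M)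
    (S : Finset ℕ) (w : ℕ → ℝ) :
    ∑ n ∈ S.filter (fun n => E n), w n =
      ∑ r ∈ (Finset.range M).filter (fun r => E r), ∑ n ∈ S.filter (fun n => n % M = r), w n := by
  rw [← Finset.sum_fiberwise_of_maps_to (g := fun n => n % M) (t := (Finset.range M).filter fun r => E r)]
  · refine Finset.sum_congr rfl fun r hr => Finset.sum_congr ?_ fun _ _ => rfl
    ext n
    simp only [Finset.mem_filter]
    constructor
    · rintro ⟨⟨h1, _⟩, h3⟩
      exact ⟨h1, h3⟩
    · rintro ⟨h1, h3⟩
      refine ⟨⟨h1, ?_⟩, h3⟩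
      have hEr := (Finset.mem_filter.mp hr).2
      rw [← h3, hE.map_mod_nat] at hEr
      exact hEr
  · intro n hn
    rw [Finset.mem_filter] at hn ⊢
    exact ⟨Finset.mem_range.mpr (Nat.mod_lt n hM), by rw [hE.map_mod_nat]; exact hn.2⟩

/-- **Re-indexing one residue class as an interval**: for `0 ≤ r < M`, `r ≤ X₁ ≤ X₂`, the `n ∈ (X₁, X₂]` with
`n ≡ r (mod M)` are the `r + M t` with `t ∈ (⌊(X₁−r)/M⌋, ⌊(X₂−r)/M⌋]`. [folklore] -/
theorem sum_filter_mod_eq_sum_Ioc {M r X₁ X₂ : ℕ} (hM : 0 < M) (hr : r < M) (hrX : r ≤ X₁) (hX : X₁ ≤ X₂)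
    (w : ℕ → ℝ) :
    ∑ n ∈ (Finset.Ioc X₁ X₂).filter (fun n => n % M = r), w n =
      ∑ t ∈ Finset.Ioc ⌊((X₁ : ℝ) - r) / M⌋₊ ⌊((X₂ : ℝ) - r) / M⌋₊, w (r + M * t) := by
  have hM' : (0 : ℝ) < M := by exact_mod_cast hM
  have h1 : (0 : ℝ) ≤ ((X₁ : ℝ) - r) / M := div_nonneg (by rw [sub_nonneg]; exact_mod_cast hrX) hM'.le
  have h2 : (0 : ℝ) ≤ ((X₂ : ℝ) - r) / M := div_nonneg (by rw [sub_nonneg]; exact_mod_cast hrX.trans hX) hM'.le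
  -- membership in the `t`-interval
  have hmem : ∀ t : ℕ, t ∈ Finset.Ioc ⌊((X₁ : ℝ) - r) / M⌋₊ ⌊((X₂ : ℝ) - r) / M⌋₊ ↔ X₁ < r + M * t ∧ r + M * t ≤ X₂ := by
    intro t
    rw [Finset.mem_Ioc, Nat.floor_lt h1, Nat.le_floor_iff h2, div_lt_iff₀ hM', le_div_iff₀ hM']
    constructor
    · rintro ⟨ha, hb⟩
      constructor
      · have : ((X₁ : ℝ)) < r + M * t := by linarith
        exact_mod_cast this
      · have : (r : ℝ) + M * t ≤ X₂ := by linarith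
        exact_mod_cast this
    · rintro ⟨ha, hb⟩
      have ha' : ((X₁ : ℕ) : ℝ) < ((r + M * t : ℕ) : ℝ) := by exact_mod_cast ha
      have hb' : ((r + M * t : ℕ) : ℝ) ≤ ((X₂ : ℕ) : ℝ) := by exact_mod_cast hb
      push_cast at ha' hb'
      constructor <;> linarith
  refine Finset.sum_nbij' (fun n => n / M) (fun t => r + M * t) ?_ ?_ ?_ ?_ ?_
  · intro n hn
    rw [Finset.mem_filter, Finset.mem_Ioc] at hn
    obtain ⟨⟨ha, hb⟩, hmod⟩ := hn
    have hn' : r + M * (n / M) = n := by rw [← hmod]; exact Nat.mod_add_div n M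
    rw [hmem, hn']
    exact ⟨ha, hb⟩
  · intro t ht
    rw [hmem] at ht
    rw [Finset.mem_filter, Finset.mem_Ioc]
    exact ⟨ht, by rw [Nat.add_mul_mod_self_left, Nat.mod_eq_of_lt hr]⟩
  · intro n hn
    rw [Finset.mem_filter] at hn
    have := Nat.mod_add_div n M
    rw [hn.2] at this
    exact this
  · intro t _
    show (r + M * t) / M = t
    rw [Nat.add_mul_div_left _ _ hM, Nat.div_eq_of_lt hr, zero_add]
  · intro n hn
    rw [Finset.mem_filter] at hn
    have := Nat.mod_add_div n M
    rw [hn.2] at this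
    rw [this]

/-! ### Root counts to smooth moduli and the class count -/

/-- `ρ_F` is multiplicative over a product of pairwise coprime factors. [folklore] -/
theorem polyRootCountMod_finset_prod (f : Fin k → ℤ[X]) {ι : Type*} (S : Finset ι) (g : ι → ℕ)
    (hcop : ∀ a ∈ S, ∀ b ∈ S, a ≠ b → (g a).Coprime (g b)) :
    polyRootCountMod f (∏ a ∈ S, g a) = ∏ a ∈ S, polyRootCountMod f (g a) := by
  induction S using Finset.induction_on with
  | empty => simp [polyRootCountMod_one]
  | insert a S ha ih =>
    rw [Finset.prod_insert ha, Finset.prod_insert ha, polyRootCountMod_mul_of_coprime_system,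
      ih fun b hb c hc hbc => hcop b (Finset.mem_insert_of_mem hb) c (Finset.mem_insert_of_mem hc) hbc]
    exact Nat.Coprime.prod_right fun b hb => hcop a (Finset.mem_insert_self a S) b (Finset.mem_insert_of_mem hb)
      fun hab => ha (hab ▸ hb)

/-- **Root counts to `P`-smooth moduli**: if `ρ_F(p^a) ≤ C` for all prime powers and `L ≥ 1` is `P`-smooth then
`ρ_F(L) ≤ C^{π(P)}` (`C ≥ 1`). [folklore] -/
theorem polyRootCountMod_smooth_le (f : Fin k → ℤ[X]) {C : ℕ} (hC : ∀ p : ℕ, p.Prime → ∀ a : ℕ, polyRootCountMod f (p ^ a) ≤ C)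
    (hC1 : 1 ≤ C) {L P : ℕ} (hL : L ≠ 0) (hLP : ∀ p ∈ L.primeFactors, p ≤ P) :
    polyRootCountMod f L ≤ C ^ (Nat.primesLE P).card := by
  conv_lhs => rw [← Nat.prod_factorization_pow_eq_self hL]
  rw [Nat.prod_factorization_eq_prod_primeFactors, polyRootCountMod_finset_prod]
  · calc ∏ p ∈ L.primeFactors, polyRootCountMod f (p ^ L.factorization p) ≤ ∏ p ∈ L.primeFactors, C :=
          Finset.prod_le_prod' fun p hp => hC p (Nat.prime_of_mem_primeFactors hp) _
      _ = C ^ L.primeFactors.card := Finset.prod_const C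
      _ ≤ C ^ (Nat.primesLE P).card := Nat.pow_le_pow_right hC1 (Finset.card_le_card fun p hp =>
          Nat.mem_primesLE.mpr ⟨hLP p hp, Nat.prime_of_mem_primeFactors hp⟩)
  · intro a ha b hb hab
    exact (Nat.coprime_pow_primes _ _ (Nat.prime_of_mem_primeFactors ha) (Nat.prime_of_mem_primeFactors hb) hab)

/-- **tailsTwo_slice_card** (registered helper of `stub_tailsTwo`, line `product-anatomy-subcritical`): the number of
residue classes `r mod M` (`M = lcm(s) · P#`) in the slice of `s` is at most `P# · ρ_F(lcm s)` — the slice conditions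
imply `lcm(s) ∣ ∏ fᵢ(r)`, a condition of exact density `ρ_F(lcm s)/lcm(s)`. [folklore] -/
theorem tailsTwo_slice_card : ∀ (k : ℕ) (f : Fin k → ℤ[X]) (s : Fin k → ℕ) (P : ℕ), (∀ i, s i ≠ 0) →
    #((Finset.range (Finset.univ.lcm s * primorial P)).filter (fun r : ℕ => ∀ i, ((s i : ℕ) : ℤ) ∣ (f i).eval (r : ℤ) ∧
      ∀ p ∈ Nat.primesLE P, ¬ ((p ^ ((s i).factorization p + 1) : ℕ) : ℤ) ∣ (f i).eval (r : ℤ))) ≤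
      primorial P * polyRootCountMod f (Finset.univ.lcm s) := by
  intro k f s P hs
  set L := Finset.univ.lcm s with hL
  calc _ ≤ #((Finset.range (L * primorial P)).filter (fun r : ℕ => (L : ℤ) ∣ ∏ i, (f i).eval (r : ℤ))) := by
        refine Finset.card_le_card fun r hr => ?_
        rw [Finset.mem_filter] at hr ⊢
        refine ⟨hr.1, ?_⟩
        have h : ∀ i, s i ∣ (∏ j, (f j).eval (r : ℤ)).natAbs := fun i => by
          rw [← Int.natCast_dvd]
          exact (hr.2 i).1.trans (Finset.dvd_prod_of_mem (fun j => (f j).eval (r : ℤ)) (Finset.mem_univ i))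
        have : L ∣ (∏ j, (f j).eval (r : ℤ)).natAbs := Finset.lcm_dvd fun i _ => h i
        rwa [← Int.natCast_dvd] at this
    _ = primorial P * polyRootCountMod f L := by
        have := card_filter_Ico_add_mul (fun r : ℕ => (L : ℤ) ∣ ∏ i, (f i).eval (r : ℤ)) (periodic_dvd_prod_eval f L)
          0 (primorial P)
        rw [zero_add, mul_comm (primorial P) L, ← Finset.range_eq_Ico] at this
        rw [this]
        rfl

end

end Summit.Parity.BatemanHorn.Cruxes.LSDRealSegment.ProductAnatomySubcritical
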